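import Summits.SmoothPoincare4.SmoothPoincare4.Theorems.ConvexBisectionAcyclicBisectionExistsBeltSlideFraming
import Mathlib.Analysis.SpecialFunctions.Sqrt
import Mathlib.Analysis.SpecialFunctions.Trigonometric.Deriv
import Mathlib.Analysis.Calculus.Deriv.Pi
import HarnessLib

/-!
# Sliding the belt circle inside the handle, V: the end framing as an explicit tangent vector
(stage 2 of node T3c-1 `node_belt_isotopic_pushoff` of the sub-goal T3 "the complement piece is the cap
with the DUAL handles" of stub `stub_steinRealisation` (NF6), line `modp-braid-orbits`, crux
`ConvexBisection.AcyclicBisectionExists`, item stmt-SmoothPoincare4-10508; begun by worker V6 in wave 2,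
completed by worker Z5 in wave 3, lead c5)

Sequel of `…BeltSlideFraming.lean`, where the end framing of the slide of the belt circle of handle
`i` was read on the base piece as the velocity `d/ds|₀ D.jA (h̄ᵢ (slideArcPt b r θ s))` of the glued
framing arc `slideArcPt b r θ s = α (R_{arcsin r} (σ (cos s θ, sin s, 0)))`.  Here that velocity is
computed: with `c = √(1 - r²)`, `σ' = ∓1` the direction sign and `θ = (θ₀, θ₁)`,

  `W(θ) = ((c² − θ₀²)/r, −σ' θ₀θ₁/r, (θ₀² − r²)/c, θ₀θ₁/c)`   (`frameW`)

(`hasDerivAt_handleInversion_arcX(_apply)`: product and chain rules through Kosinski's inversion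
`α(x) = (x_λ √(1-L)/√L, x_μ √L/√(1-L))`, `L = |x_λ|²`, with `L(0) = r²`, `L'(0) = 2 r c θ₀`), so that
the end framed knot of stages 1–2 is, entirely in tree vocabulary on the base side,

  `(θ ↦ D.jA (h̄ᵢ (y θ)),  θ ↦ d(D.jA) (d h̄ᵢ (Dι⁻¹ W(θ))))`,  `y θ = (c θ₀, σ' c θ₁, r θ₀, r θ₁) ∈ T`

(`attachingFraming_slideMap_one_eq_mfderiv`; `Dι = closedBallCoeDeriv` reads ambient vectors of `ℝ⁴` in
the charts of `D⁴ ⊇ T`).  Modulo the velocity of the longitude, `W ≡ θ₀ N − θ₁ B'` with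
`N = (−r u, c θ)` the outward tube normal and `B' = (r σ' iu, −c iθ)` the in-torus normal
(`u = (θ₀, σ' θ₁)`): the carried belt framing is the tube-normal framing of the `r`-longitude with one
extra twist — the datum the Lefschetz-specific stages 3–4 start from.

* §1 `hasDerivAt_sqrt_one_sub`, `hasDerivAt_sqrt_div`, `hasDerivAt_sqrt_div'` (calculus of `√(1-L)/√L`);
  `arcX`, `frameW`, `hasDerivAt_handleInversion_arcX_apply`, `hasDerivAt_handleInversion_arcX`;
* §2 `hasDerivAt_coe_coe_slideArcPt`, `contMDiffAt_slideArcPt_zero`, `mfderiv_slideArcPt_zero`,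
  **`attachingFraming_slideMap_one_eq_mfderiv`**, registered helper `helper_belt_slideFramingVector`.

Everything is proved; no named facts.

## References
* A. A. Kosinski, *Differential Manifolds*, Academic Press (1993), VI §6, (6.1). [Kosinski1993]
* R. C. Kirby, *The Topology of 4-Manifolds*, LNM 1374 (1989), Ch. I §2 (framings). [Kirby1989]
-/

noncomputable section

-- the prescribed namespace `Summit.<P>.<Sub>.…` duplicates `SmoothPoincare4` (P = Sub)
set_option linter.dupNamespace false

open scoped Manifold ContDiff Topology
open Set Function Metric Real

namespace Summit.SmoothPoincare4.SmoothPoincare4.Theorems.AcyclicBisectionExists.ModpBraidOrbits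

open Literature.Topology.FourManifolds Literature.Topology.FourManifolds.HandleAttachingMap
  Literature.Geometry.Symplectic

/-! ### §1 The velocity of the glued framing arc, in coordinates -/

/-- Derivative of `x ↦ √(1 - x)` at `L < 1`. [folklore] -/
theorem hasDerivAt_sqrt_one_sub {L : ℝ} (h1 : L < 1) :
    HasDerivAt (fun x => Real.sqrt (1 - x)) (-1 / (2 * Real.sqrt (1 - L))) L := by
  have h := (Real.hasDerivAt_sqrt (x := 1 - L) (by linarith)).comp L ((hasDerivAt_id L).const_sub 1)
  refine (h.congr_of_eventuallyEq (Filter.Eventually.of_forall fun y => rfl)).congr_deriv ?_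
  simp; ring

/-- Derivative of `G(L) = √(1-L)/√L` on `(0, 1)`: `-1/(2 (√L)³ √(1-L))`. [folklore] -/
theorem hasDerivAt_sqrt_div {L : ℝ} (h0 : 0 < L) (h1 : L < 1) :
    HasDerivAt (fun x => Real.sqrt (1 - x) / Real.sqrt x)
      (-(1 / (2 * Real.sqrt L ^ 3 * Real.sqrt (1 - L)))) L := by
  have hp : 0 < Real.sqrt L := Real.sqrt_pos.2 h0
  have hq : 0 < Real.sqrt (1 - L) := Real.sqrt_pos.2 (by linarith)
  have hp2 : Real.sqrt L ^ 2 = L := Real.sq_sqrt h0.le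
  have hq2 : Real.sqrt (1 - L) ^ 2 = 1 - L := Real.sq_sqrt (by linarith)
  refine ((hasDerivAt_sqrt_one_sub h1).fun_div (Real.hasDerivAt_sqrt h0.ne') hp.ne').congr_deriv ?_
  field_simp
  nlinarith [hp2, hq2]

/-- Derivative of `K(L) = √L/√(1-L)` on `(0, 1)`: `1/(2 √L (√(1-L))³)`. [folklore] -/
theorem hasDerivAt_sqrt_div' {L : ℝ} (h0 : 0 < L) (h1 : L < 1) :
    HasDerivAt (fun x => Real.sqrt x / Real.sqrt (1 - x))
      (1 / (2 * Real.sqrt L * Real.sqrt (1 - L) ^ 3)) L := by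
  have hp : 0 < Real.sqrt L := Real.sqrt_pos.2 h0
  have hq : 0 < Real.sqrt (1 - L) := Real.sqrt_pos.2 (by linarith)
  have hp2 : Real.sqrt L ^ 2 = L := Real.sq_sqrt h0.le
  have hq2 : Real.sqrt (1 - L) ^ 2 = 1 - L := Real.sq_sqrt (by linarith)
  refine ((Real.hasDerivAt_sqrt h0.ne').fun_div (hasDerivAt_sqrt_one_sub h1) hq.ne').congr_deriv ?_
  field_simp
  nlinarith [hp2, hq2]

/-- The explicit slid framing arc before inversion, `R_{arcsin r} (σ (cos s θ, sin s, 0))`, as a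
function of `s` with values in `Fin 4 → ℝ` (`σ' = ±1` the direction sign). [folklore] -/
def arcX (σ' r θ₀ θ₁ : ℝ) (s : ℝ) : Fin 4 → ℝ :=
  ![Real.sqrt (1 - r ^ 2) * sin s + r * cos s * θ₀, σ' * r * cos s * θ₁,
    -r * sin s + Real.sqrt (1 - r ^ 2) * cos s * θ₀, Real.sqrt (1 - r ^ 2) * cos s * θ₁]

/-- **The end framing vector** `W(θ) = d/ds|₀ α (R (σ (cos s θ, sin s, 0)))`:
`((c² − θ₀²)/r, −σ' θ₀ θ₁/r, (θ₀² − r²)/c, θ₀ θ₁/c)`, `c = √(1 − r²)`. [folklore] -/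
def frameW (σ' r θ₀ θ₁ : ℝ) : Fin 4 → ℝ :=
  ![((1 - r ^ 2) - θ₀ ^ 2) / r, -(σ' * θ₀ * θ₁) / r, (θ₀ ^ 2 - r ^ 2) / Real.sqrt (1 - r ^ 2),
    θ₀ * θ₁ / Real.sqrt (1 - r ^ 2)]

/-- **The velocity at `s = 0` of the glued framing arc** `s ↦ α (arcX s)` is `frameW`, coordinatewise
(`0 < r < 1`, `θ₀² + θ₁² = 1`, `σ'² = 1`). [cite: Kosinski1993, VI (6.1)] -/
theorem hasDerivAt_handleInversion_arcX_apply {σ' r θ₀ θ₁ : ℝ} (hσ : σ' ^ 2 = 1) (h0 : 0 < r) (h1 : r < 1)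
    (hθ : θ₀ ^ 2 + θ₁ ^ 2 = 1) (i : Fin 4) :
    HasDerivAt (fun s => (handleInversion 2 (WithLp.toLp 2 (arcX σ' r θ₀ θ₁ s)) : EuclideanSpace ℝ (Fin 4)) i)
      (frameW σ' r θ₀ θ₁ i) 0 := by
  set c := Real.sqrt (1 - r ^ 2) with hc
  have hc0 : 0 < c := Real.sqrt_pos.2 (by nlinarith)
  have hcsq : c ^ 2 = 1 - r ^ 2 := Real.sq_sqrt (by nlinarith)
  have hr2 : (0 : ℝ) < r ^ 2 := by positivity
  have hr2' : r ^ 2 < 1 := by nlinarith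
  have hsqL : Real.sqrt (r ^ 2) = r := Real.sqrt_sq h0.le
  -- the coordinate functions and their derivatives at `0`
  have ha : HasDerivAt (fun s => c * sin s + r * cos s * θ₀) c 0 :=
    (((Real.hasDerivAt_sin 0).const_mul c).fun_add
      (((Real.hasDerivAt_cos 0).const_mul r).mul_const θ₀)).congr_deriv (by simp)
  have hb : HasDerivAt (fun s => σ' * r * cos s * θ₁) 0 0 :=
    (((Real.hasDerivAt_cos 0).const_mul (σ' * r)).mul_const θ₁).congr_deriv (by simp)
  have hc' : HasDerivAt (fun s => -r * sin s + c * cos s * θ₀) (-r) 0 :=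
    (((Real.hasDerivAt_sin 0).const_mul (-r)).fun_add
      (((Real.hasDerivAt_cos 0).const_mul c).mul_const θ₀)).congr_deriv (by simp)
  have hd : HasDerivAt (fun s => c * cos s * θ₁) 0 0 :=
    (((Real.hasDerivAt_cos 0).const_mul c).mul_const θ₁).congr_deriv (by simp)
  -- `L = a² + b²`, `L(0) = r²`, `L'(0) = 2 r c θ₀`
  set Lf : ℝ → ℝ := fun s => (c * sin s + r * cos s * θ₀) ^ 2 + (σ' * r * cos s * θ₁) ^ 2 with hLf
  have hL : HasDerivAt Lf (2 * (r * θ₀) * c) 0 := by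
    refine ((ha.fun_pow 2).fun_add (hb.fun_pow 2)).congr_deriv ?_
    simp
  have hL0 : Lf 0 = r ^ 2 := by
    simp [hLf]; linear_combination (r ^ 2) * hθ + (r ^ 2 * θ₁ ^ 2) * hσ
  set G₁ : ℝ → ℝ := fun s => Real.sqrt (1 - Lf s) / Real.sqrt (Lf s) with hG₁
  set K₁ : ℝ → ℝ := fun s => Real.sqrt (Lf s) / Real.sqrt (1 - Lf s) with hK₁
  have hGL : HasDerivAt G₁ (-(1 / (2 * r ^ 3 * c)) * (2 * (r * θ₀) * c)) 0 := by
    have hG : HasDerivAt (fun x => Real.sqrt (1 - x) / Real.sqrt x) (-(1 / (2 * r ^ 3 * c))) (Lf 0) := by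
      rw [hL0]
      have := hasDerivAt_sqrt_div hr2 hr2'
      rwa [hsqL] at this
    exact hG.comp 0 hL
  have hKL : HasDerivAt K₁ ((1 / (2 * r * c ^ 3)) * (2 * (r * θ₀) * c)) 0 := by
    have hK : HasDerivAt (fun x => Real.sqrt x / Real.sqrt (1 - x)) (1 / (2 * r * c ^ 3)) (Lf 0) := by
      rw [hL0]
      have := hasDerivAt_sqrt_div' hr2 hr2'
      rwa [hsqL] at this
    exact hK.comp 0 hL
  have hG0 : G₁ 0 = c / r := by simp only [hG₁]; rw [hL0, hsqL]
  have hK0 : K₁ 0 = r / c := by simp only [hK₁]; rw [hL0, hsqL]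
  -- the coordinates of `α (arcX s)`
  have hlam : ∀ s, lamSq 2 (WithLp.toLp 2 (arcX σ' r θ₀ θ₁ s) : EuclideanSpace ℝ (Fin 4)) = Lf s := by
    intro s
    rw [lamSq_two_fin_four]
    simp [arcX, hLf, ← hc]
  have e : ∀ j : Fin 4, (fun s => (handleInversion 2 (WithLp.toLp 2 (arcX σ' r θ₀ θ₁ s)) : EuclideanSpace ℝ (Fin 4)) j) =
      fun s => if (j : ℕ) < 2 then arcX σ' r θ₀ θ₁ s j * G₁ s else arcX σ' r θ₀ θ₁ s j * K₁ s := by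
    intro j; funext s
    rw [handleInversion_apply, hlam]
  rw [e]
  fin_cases i
  · refine (ha.fun_mul hGL).congr_of_eventuallyEq (Filter.Eventually.of_forall fun s => ?_) |>.congr_deriv ?_
    · simp [arcX, ← hc]
    · rw [hG0]; simp [frameW]; field_simp; nlinarith [hcsq]
  · refine (hb.fun_mul hGL).congr_of_eventuallyEq (Filter.Eventually.of_forall fun s => ?_) |>.congr_deriv ?_
    · simp [arcX]
    · rw [hG0]; simp [frameW]; field_simp
  · refine (hc'.fun_mul hKL).congr_of_eventuallyEq (Filter.Eventually.of_forall fun s => ?_) |>.congr_deriv ?_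
    · simp [arcX, ← hc]
    · rw [hK0]; simp [frameW, ← hc]; field_simp; ring
  · refine (hd.fun_mul hKL).congr_of_eventuallyEq (Filter.Eventually.of_forall fun s => ?_) |>.congr_deriv ?_
    · simp [arcX, ← hc]
    · rw [hK0]; simp [frameW, ← hc]; field_simp


/-- **The velocity at `s = 0` of the glued framing arc** `s ↦ α (arcX s) ∈ ℝ⁴` is `frameW`.
[cite: Kosinski1993, VI (6.1)] -/
theorem hasDerivAt_handleInversion_arcX {σ' r θ₀ θ₁ : ℝ} (hσ : σ' ^ 2 = 1) (h0 : 0 < r) (h1 : r < 1)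
    (hθ : θ₀ ^ 2 + θ₁ ^ 2 = 1) :
    HasDerivAt (fun s => (handleInversion 2 (WithLp.toLp 2 (arcX σ' r θ₀ θ₁ s)) : EuclideanSpace ℝ (Fin 4)))
      (WithLp.toLp 2 (frameW σ' r θ₀ θ₁)) 0 := by
  have hP : HasDerivAt (fun s => fun i => (handleInversion 2 (WithLp.toLp 2 (arcX σ' r θ₀ θ₁ s)) :
      EuclideanSpace ℝ (Fin 4)) i) (fun i => frameW σ' r θ₀ θ₁ i) 0 :=
    hasDerivAt_pi.2 fun i => hasDerivAt_handleInversion_arcX_apply hσ h0 h1 hθ i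
  have h := ((PiLp.continuousLinearEquiv 2 ℝ (fun _ : Fin 4 => ℝ)).symm.toContinuousLinearMap.hasFDerivAt).comp_hasDerivAt
    (0 : ℝ) hP
  exact h

/-! ### §2 The end framing of the slide as a tangent vector at the `r`-longitude point -/

section EndFraming

/-- **The glued framing arc, read in `ℝ⁴`, has velocity `frameW` at `s = 0`** (`0 < r ≤ 1/2`).
[cite: Kosinski1993, VI (6.1)] -/
theorem hasDerivAt_coe_coe_slideArcPt (b : Bool) {r : ℝ} (h0 : 0 < r) (h1 : r ≤ 1 / 2)
    (θ : sphere (0 : EuclideanSpace ℝ (Fin 2)) 1) :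
    HasDerivAt (fun s => (((slideArcPt b r θ s : ↥(handleTube 3 2)) : closedBall (0 : EuclideanSpace ℝ (Fin 4)) 1) :
      EuclideanSpace ℝ (Fin 4)))
      (WithLp.toLp 2 (frameW (slideSign b) r ((θ : EuclideanSpace ℝ (Fin 2)) 0) ((θ : EuclideanSpace ℝ (Fin 2)) 1))) 0 := by
  have hθ : (θ : EuclideanSpace ℝ (Fin 2)) 0 ^ 2 + (θ : EuclideanSpace ℝ (Fin 2)) 1 ^ 2 = 1 := by
    have h2 : ‖(θ : EuclideanSpace ℝ (Fin 2))‖ ^ 2 = 1 := by rw [norm_eq_of_mem_sphere θ, one_pow]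
    rwa [EuclideanSpace.real_norm_sq_eq, Fin.sum_univ_two] at h2
  refine (hasDerivAt_handleInversion_arcX (slideSign_sq b) h0 (by linarith) hθ).congr_of_eventuallyEq ?_
  filter_upwards [eventually_coe_coe_slideArcPt b h0 h1 θ] with s hs
  rw [hs]
  rfl

/-- Near `s = 0` the glued framing arc is Kosinski's inversion `α` (as the partial diffeomorphism
`handleInversionPH : D⁴ ∖ S ⇀ T`) of the slid framing arc. [folklore] -/
theorem slideArcPt_eventuallyEq (b : Bool) {r : ℝ} (h0 : 0 < r) (h1 : r ≤ 1 / 2)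
    (θ : sphere (0 : EuclideanSpace ℝ (Fin 2)) 1) :
    slideArcPt b r θ =ᶠ[𝓝 0] fun s => handleInversionPH 3 2 (slideInner b r 1 (tubeArcPt θ s)) := by
  filter_upwards [eventually_lamSq_slideInner_tubeArcPt_ne_zero b h0 h1 θ] with s hs
  rw [handleInversionPH_apply 3 2 hs, slideArcPt, dif_pos hs]

/-- **The glued framing arc is smooth at `s = 0`** (as a curve in `T`; `0 < r ≤ 1/2`). [folklore] -/
theorem contMDiffAt_slideArcPt_zero (b : Bool) {r : ℝ} (h0 : 0 < r) (h1 : r ≤ 1 / 2)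
    (θ : sphere (0 : EuclideanSpace ℝ (Fin 2)) 1) :
    ContMDiffAt 𝓘(ℝ, ℝ) (𝓡∂ 4) ∞ (slideArcPt b r θ) 0 := by
  have h0' := (eventually_lamSq_slideInner_tubeArcPt_ne_zero b h0 h1 θ).self_of_nhds
  have hsrc : slideInner b r 1 (tubeArcPt θ 0) ∈ (handleInversionPH 3 2).source := by
    rw [handleInversionPH_source]; exact h0'
  have h1' : ContMDiffAt (𝓡∂ 4) (𝓡∂ 4) ∞ (handleInversionPH 3 2) (slideInner b r 1 (tubeArcPt θ 0)) :=
    (contMDiffOn_handleInversionPH 3 2).contMDiffAt ((handleInversionPH 3 2).open_source.mem_nhds hsrc)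
  have h2' : ContMDiffAt 𝓘(ℝ, ℝ) (𝓡∂ 4) ∞ (fun s => slideInner b r 1 (tubeArcPt θ s)) 0 :=
    (contMDiff_slideInner b r 1).contMDiffAt.comp 0 (contMDiffAt_tubeArcPt (by rw [Real.cos_zero]; exact one_pos))
  exact (h1'.comp 0 h2').congr_of_eventuallyEq (slideArcPt_eventuallyEq b h0 h1 θ)

/-- **The chart velocity of the glued framing arc at `s = 0`** is `Dι⁻¹ W` at the `r`-longitude point
(`Dι = closedBallCoeDeriv`). [cite: Kosinski1993, VI (6.1)] -/
theorem mfderiv_slideArcPt_zero (b : Bool) {r : ℝ} (h0 : 0 < r) (h1 : r ≤ 1 / 2)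
    (θ : sphere (0 : EuclideanSpace ℝ (Fin 2)) 1) :
    mfderiv 𝓘(ℝ, ℝ) (𝓡∂ 4) (slideArcPt b r θ) 0 (1 : ℝ) =
      (closedBallCoeDeriv ((slideArcPt b r θ 0 : ↥(handleTube 3 2)) : closedBall (0 : EuclideanSpace ℝ (Fin 4)) 1)).symm
        (WithLp.toLp 2 (frameW (slideSign b) r ((θ : EuclideanSpace ℝ (Fin 2)) 0) ((θ : EuclideanSpace ℝ (Fin 2)) 1))) := by
  have hγd : MDifferentiableAt 𝓘(ℝ, ℝ) (𝓡∂ 4) (slideArcPt b r θ) 0 :=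
    (contMDiffAt_slideArcPt_zero b h0 h1 θ).mdifferentiableAt (by simp)
  have hval : HasMFDerivAt (𝓡∂ 4) 𝓘(ℝ, EuclideanSpace ℝ (Fin 4))
      (fun y : ↥(handleTube 3 2) => ((y : closedBall (0 : EuclideanSpace ℝ (Fin 4)) 1) : EuclideanSpace ℝ (Fin 4)))
      (slideArcPt b r θ 0)
      (closedBallCoeDeriv ((slideArcPt b r θ 0 : ↥(handleTube 3 2)) : closedBall (0 : EuclideanSpace ℝ (Fin 4)) 1) :
        EuclideanSpace ℝ (Fin 4) →L[ℝ] EuclideanSpace ℝ (Fin 4)) :=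
    hasMFDerivAt_restrict_opens (handleTube 3 2) (hasMFDerivAt_coe_closedBall _)
  have h2 := hval.comp 0 hγd.hasMFDerivAt
  have h1' : HasMFDerivAt 𝓘(ℝ, ℝ) 𝓘(ℝ, EuclideanSpace ℝ (Fin 4))
      ((fun y : ↥(handleTube 3 2) => ((y : closedBall (0 : EuclideanSpace ℝ (Fin 4)) 1) : EuclideanSpace ℝ (Fin 4))) ∘
        slideArcPt b r θ) 0
      (ContinuousLinearMap.smulRight (1 : ℝ →L[ℝ] ℝ)
        (WithLp.toLp 2 (frameW (slideSign b) r ((θ : EuclideanSpace ℝ (Fin 2)) 0) ((θ : EuclideanSpace ℝ (Fin 2)) 1)))) :=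
    (hasDerivAt_coe_coe_slideArcPt b h0 h1 θ).hasFDerivAt.hasMFDerivAt
  have h3 := h2.mfderiv.symm.trans h1'.mfderiv
  have h4 : closedBallCoeDeriv ((slideArcPt b r θ 0 : ↥(handleTube 3 2)) : closedBall (0 : EuclideanSpace ℝ (Fin 4)) 1)
      (mfderiv 𝓘(ℝ, ℝ) (𝓡∂ 4) (slideArcPt b r θ) 0 (1 : ℝ)) =
      (1 : ℝ) • (WithLp.toLp 2 (frameW (slideSign b) r ((θ : EuclideanSpace ℝ (Fin 2)) 0) ((θ : EuclideanSpace ℝ (Fin 2)) 1)) :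
        EuclideanSpace ℝ (Fin 4)) :=
    congrArg (fun L : ℝ →L[ℝ] EuclideanSpace ℝ (Fin 4) => L 1) h3
  rw [one_smul] at h4
  exact ((closedBallCoeDeriv ((slideArcPt b r θ 0 : ↥(handleTube 3 2)) :
    closedBall (0 : EuclideanSpace ℝ (Fin 4)) 1)).symm_apply_apply _).symm.trans
    (congrArg (closedBallCoeDeriv ((slideArcPt b r θ 0 : ↥(handleTube 3 2)) :
      closedBall (0 : EuclideanSpace ℝ (Fin 4)) 1)).symm h4)

variable {ι : Type*} [Finite ι] {M : Type*} [TopologicalSpace M] [T2Space M]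
  [ChartedSpace (EuclideanHalfSpace 4) M] {h : ι → HandleAttachingMap 3 2 M}
  {P : Type*} [TopologicalSpace P] [ChartedSpace (EuclideanHalfSpace 4) P]
  (D : MultiAttachmentData h (𝓡∂ 4) P) (i : ι) (b : Bool)

/-- **The end framing of the slide as a tangent vector**: for `0 < r ≤ 1/2`,
`ν₁(θ) = d(D.jA) (d h̄ᵢ (Dι⁻¹ W(θ)))` at the `r`-longitude point `y θ = tubeLongitudePt b r θ`
(chain rule through the open submanifold `M ∖ ⋃ cores` and Kosinski's tube). [cite: Kirby1989, Ch. I §2] -/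
theorem attachingFraming_slideMap_one_eq_mfderiv {r : ℝ} (h0 : 0 < r) (h1 : r ≤ 1 / 2)
    (θ : sphere (0 : EuclideanSpace ℝ (Fin 2)) 1) :
    (slideMap D i b r 1).attachingFraming θ =
      mfderiv (𝓡∂ 4) (𝓡∂ 4) (fun a : ↥(coresComplement h) => D.jA a)
        ⟨(h i).toFun (tubeLongitudePt b r θ), BeltPageClause.apply_mem_coresComplement_of_lamSq_ne_one
          D.disjoint i _ (lamSq_tubeLongitudePt_ne_one b h0.ne' (by nlinarith) θ)⟩
        (mfderiv (𝓡∂ 4) (𝓡∂ 4) (h i).toFun (tubeLongitudePt b r θ)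
          ((closedBallCoeDeriv ((tubeLongitudePt b r θ : ↥(handleTube 3 2)) :
            closedBall (0 : EuclideanSpace ℝ (Fin 4)) 1)).symm
            (WithLp.toLp 2 (frameW (slideSign b) r ((θ : EuclideanSpace ℝ (Fin 2)) 0) ((θ : EuclideanSpace ℝ (Fin 2)) 1))))) := by
  rw [attachingFraming_slideMap_one D i b h0 h1 θ]
  -- the lifted curve `γ s = h̄ (slideArcPt s)` in `M ∖ ⋃ cores` and its derivative at `0`
  set γ : ℝ → ↥(coresComplement h) := fun s => ⟨(h i).toFun (slideArcPt b r θ s),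
    BeltPageClause.apply_mem_coresComplement_of_lamSq_ne_one D.disjoint i _ (lamSq_slideArcPt_ne_one b r θ s)⟩ with hγ
  have hγd : MDifferentiableAt 𝓘(ℝ, ℝ) (𝓡∂ 4) (slideArcPt b r θ) 0 :=
    (contMDiffAt_slideArcPt_zero b h0 h1 θ).mdifferentiableAt (by simp)
  have hcomp : HasMFDerivAt 𝓘(ℝ, ℝ) (𝓡∂ 4) ((h i).toFun ∘ slideArcPt b r θ) 0
      ((mfderiv (𝓡∂ 4) (𝓡∂ 4) (h i).toFun (slideArcPt b r θ 0)).comp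
        (mfderiv 𝓘(ℝ, ℝ) (𝓡∂ 4) (slideArcPt b r θ) 0)) :=
    (mdifferentiableAt_handleAttachingMap (h i) _).hasMFDerivAt.comp 0 hγd.hasMFDerivAt
  have hγ' : HasMFDerivAt 𝓘(ℝ, ℝ) (𝓡∂ 4) γ 0
      ((mfderiv (𝓡∂ 4) (𝓡∂ 4) (h i).toFun (slideArcPt b r θ 0)).comp
        (mfderiv 𝓘(ℝ, ℝ) (𝓡∂ 4) (slideArcPt b r θ) 0)) :=
    hasMFDerivAt_codRestrict_opens (f := (h i).toFun ∘ slideArcPt b r θ) (fun s => rfl) hcomp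
  have hA : MDifferentiableAt (𝓡∂ 4) (𝓡∂ 4) (fun a : ↥(coresComplement h) => D.jA a) (γ 0) :=
    D.hjA.contMDiff.mdifferentiableAt (by simp)
  have htot := hA.hasMFDerivAt.comp 0 hγ'
  have e : (fun s => D.jA ⟨(h i).toFun (slideArcPt b r θ s),
      BeltPageClause.apply_mem_coresComplement_of_lamSq_ne_one D.disjoint i _ (lamSq_slideArcPt_ne_one b r θ s)⟩) =
      (fun a : ↥(coresComplement h) => D.jA a) ∘ γ := rfl
  have hfin : mfderiv 𝓘(ℝ, ℝ) (𝓡∂ 4) ((fun a : ↥(coresComplement h) => D.jA a) ∘ γ) 0 (1 : ℝ) =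
      mfderiv (𝓡∂ 4) (𝓡∂ 4) (fun a : ↥(coresComplement h) => D.jA a) (γ 0)
        (mfderiv (𝓡∂ 4) (𝓡∂ 4) (h i).toFun (slideArcPt b r θ 0)
          (mfderiv 𝓘(ℝ, ℝ) (𝓡∂ 4) (slideArcPt b r θ) 0 (1 : ℝ))) :=
    congrArg (fun L : ℝ →L[ℝ] EuclideanSpace ℝ (Fin 4) => L 1) htot.mfderiv
  rw [e]
  refine hfin.trans ?_
  rw [mfderiv_slideArcPt_zero b h0 h1 θ]
  -- move the base point from `slideArcPt b r θ 0` to `tubeLongitudePt b r θ`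
  have hpt : slideArcPt b r θ 0 = tubeLongitudePt b r θ := slideArcPt_zero b h0 h1 θ
  have hγ0 : γ 0 = ⟨(h i).toFun (tubeLongitudePt b r θ), BeltPageClause.apply_mem_coresComplement_of_lamSq_ne_one
      D.disjoint i _ (lamSq_tubeLongitudePt_ne_one b h0.ne' (by nlinarith) θ)⟩ := by
    apply Subtype.ext
    show (h i).toFun (slideArcPt b r θ 0) = (h i).toFun (tubeLongitudePt b r θ)
    rw [hpt]
  rw [hγ0, hpt]

end EndFraming

/-! ### §3 Registered helper -/

/-- **Registered helper `helper_belt_slideFramingVector` (stage 2 of node T3c-1 of NF6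
`stub_steinRealisation`, wave 2, lead c5): the end framing of the belt-circle slide as an explicit
tangent vector.**  In the situation of `helper_belt_slide` (`…BeltSlideFraming.lean`), the end
framing of component `i` at `θ` is `d(D.jA) (d h̄ᵢ (Dι⁻¹ W))` at the `r`-longitude point
`(√(1-r²) θ₀, ∓√(1-r²) θ₁, r θ₀, r θ₁) ∈ T`, `W = ((1-r²-θ₀²)/r, ∓(−θ₀θ₁)/r…, (θ₀²-r²)/√(1-r²), θ₀θ₁/√(1-r²))`.
[cite: Kosinski1993, VI §6] -/
theorem helper_belt_slideFramingVector :
    ∀ {ι : Type} [Finite ι] {M : Type} [TopologicalSpace M] [T2Space M]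
      [ChartedSpace (EuclideanHalfSpace 4) M]
      {h : ι → Literature.Topology.FourManifolds.HandleAttachingMap 3 2 M}
      {P : Type} [TopologicalSpace P] [T2Space P] [ChartedSpace (EuclideanHalfSpace 4) P]
      [IsManifold (𝓡∂ 4) ∞ P]
      (D : Literature.Topology.FourManifolds.HandleAttachingMap.MultiAttachmentData h (𝓡∂ 4) P)
      (b : ι → Bool) (r : ι → ℝ), (∀ i, 0 < r i) → (∀ i, r i ≤ 1 / 2) →
      ∃ (q : ι → ℝ → Literature.Topology.FourManifolds.HandleAttachingMap 3 2 P)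
        (y : ι → Metric.sphere (0 : EuclideanSpace ℝ (Fin 2)) 1 →
          ↥(Literature.Topology.FourManifolds.handleTube 3 2))
        (hy : ∀ i θ, (h i).toFun (y i θ) ∈
          Literature.Topology.FourManifolds.HandleAttachingMap.coresComplement h)
        (Φ : Literature.Geometry.Symplectic.LinkIsotopyInBoundary
          (fun i => (Summit.SmoothPoincare4.SmoothPoincare4.Theorems.AcyclicBisectionExists.ModpBraidOrbits.beltMap
            D i).attachingCircle)
          (fun i θ => D.jA ⟨(h i).toFun (y i θ), hy i θ⟩)),
        (∀ i t, (Φ.isotopy i).toFun t = (q i t).attachingCircle) ∧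
        (∀ i, Literature.Geometry.Symplectic.IsFramingAlong (Φ.isotopy i)
          (Summit.SmoothPoincare4.SmoothPoincare4.Theorems.AcyclicBisectionExists.ModpBraidOrbits.beltMap
            D i).attachingFraming fun t => (q i t).attachingFraming) ∧
        (∀ i t, Set.range (q i t).toFun ⊆ Set.range (D.jB i)) ∧
        (∀ i θ, (((y i θ : ↥(Literature.Topology.FourManifolds.handleTube 3 2)) :
            Metric.closedBall (0 : EuclideanSpace ℝ (Fin 4)) 1) : EuclideanSpace ℝ (Fin 4)) =
          WithLp.toLp 2 ![Real.sqrt (1 - r i ^ 2) * (θ : EuclideanSpace ℝ (Fin 2)) 0,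
            (if b i then -1 else 1) * Real.sqrt (1 - r i ^ 2) * (θ : EuclideanSpace ℝ (Fin 2)) 1,
            r i * (θ : EuclideanSpace ℝ (Fin 2)) 0, r i * (θ : EuclideanSpace ℝ (Fin 2)) 1]) ∧
        (∀ i θ, (q i 1).attachingFraming θ =
          mfderiv (𝓡∂ 4) (𝓡∂ 4)
            (fun a : ↥(Literature.Topology.FourManifolds.HandleAttachingMap.coresComplement h) => D.jA a)
            ⟨(h i).toFun (y i θ), hy i θ⟩
            (mfderiv (𝓡∂ 4) (𝓡∂ 4) (h i).toFun (y i θ)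
              ((Literature.Topology.FourManifolds.closedBallCoeDeriv
                ((y i θ : ↥(Literature.Topology.FourManifolds.handleTube 3 2)) :
                  Metric.closedBall (0 : EuclideanSpace ℝ (Fin 4)) 1)).symm
                (WithLp.toLp 2 ![((1 - r i ^ 2) - (θ : EuclideanSpace ℝ (Fin 2)) 0 ^ 2) / r i,
                  -((if b i then -1 else 1) * (θ : EuclideanSpace ℝ (Fin 2)) 0 * (θ : EuclideanSpace ℝ (Fin 2)) 1) / r i,
                  ((θ : EuclideanSpace ℝ (Fin 2)) 0 ^ 2 - r i ^ 2) / Real.sqrt (1 - r i ^ 2),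
                  (θ : EuclideanSpace ℝ (Fin 2)) 0 * (θ : EuclideanSpace ℝ (Fin 2)) 1 / Real.sqrt (1 - r i ^ 2)])))) := by
  intro ι _ M _ _ _ h P _ _ _ _ D b r hr0 hr1
  obtain ⟨q, y, hy, Φ, hΦ, hfr, hrange, hcoord⟩ := helper_belt_slideLongitude D b r hr0 hr1
  -- `helper_belt_slideLongitude` is realised by `slideMap`/`tubeLongitudePt`; redo it transparently
  have hsq : ∀ i, r i ^ 2 < 1 := fun i => by nlinarith [hr0 i, hr1 i]
  have key : ∀ (L' : ι → sphere (0 : EuclideanSpace ℝ (Fin 2)) 1 → P)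
      (_ : (fun i => (slideMap D i (b i) (r i) 1).attachingCircle) = L'),
      ∃ Φ : Literature.Geometry.Symplectic.LinkIsotopyInBoundary (fun i => (beltMap D i).attachingCircle) L',
        (∀ i t, (Φ.isotopy i).toFun t = (slideMap D i (b i) (r i) t).attachingCircle) ∧
        ∀ i, Literature.Geometry.Symplectic.IsFramingAlong (Φ.isotopy i) (beltMap D i).attachingFraming
          fun t => (slideMap D i (b i) (r i) t).attachingFraming := by
    intro L' e
    subst e
    exact ⟨slideLinkIsotopy D b r, fun i t => rfl, fun i => isFramingAlong_slide D i (b i) (r i)⟩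
  obtain ⟨Φ', hΦ', hfr'⟩ := key (fun i θ => D.jA ⟨(h i).toFun (tubeLongitudePt (b i) (r i) θ),
    BeltPageClause.apply_mem_coresComplement_of_lamSq_ne_one D.disjoint i _
      (lamSq_tubeLongitudePt_ne_one (b i) (hr0 i).ne' (hsq i) θ)⟩)
    (funext fun i => funext fun θ => attachingCircle_slideMap_one D i (b i) (hr0 i) (hr1 i) θ)
  refine ⟨fun i t => slideMap D i (b i) (r i) t, fun i θ => tubeLongitudePt (b i) (r i) θ, _, Φ', hΦ', hfr',
    fun i t => range_slideMap_subset D i (b i) (r i) t, fun i θ => ?_, fun i θ => ?_⟩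
  · rw [coe_coe_tubeLongitudePt (b i) (hsq i)]; rfl
  · exact attachingFraming_slideMap_one_eq_mfderiv D i (b i) (hr0 i) (hr1 i) θ

end Summit.SmoothPoincare4.SmoothPoincare4.Theorems.AcyclicBisectionExists.ModpBraidOrbits

end
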